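import Literature.Combinatorics.Optimization.HexagonComplexPsdRank
import Literature.Combinatorics.Designs.HadamardDesign
import Literature.Combinatorics.Designs.HadamardOrder
import Literature.Combinatorics.Designs.PaleyConstruction
import Mathlib.Analysis.Fourier.ZMod
import HarnessLib

/-!
# The complex psd rank of the nonequality matrix (Lee–Wei–de Wolf 2017, §6.1: Lemma 37, Theorem 38,
# Example 41; Lemma 39 / Theorem 40 for Hadamard orders) — PROVED

Source: T. Lee, Z. Wei, R. de Wolf, *Some upper and lower bounds on PSD-rank*, Math. Program. 162
(2017) 495–521 = arXiv:1407.4308 [LeeWeiDeWolf2017]; held text `paper:arxiv-1407.4308`, p12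
(`pNN` = held-text chunk). "PSD-rank" there has complex Hermitian factors
(`HasComplexPsdFactorization`, `HexagonComplexPsdRank.lean`); the nonequality matrix
`NE(x,y) = [x ≠ y]` of size `N` is the tree's `derangementMatrix N` (`PsdRankComparisons.lean`, whose
`FawziEtAl2015_ex51_holds` gives the REAL psd rank `min{k : N ≤ C(k+1,2)}`).

Printed statements (p12, verbatim). "**Lemma 37.** Let `n` be odd. Then there are `n²` Hermitian
matrices `G_{ij}` of size `n` such that `Tr(G_{ij}) = Tr(G_{kl})` for all `i,j,k,l ∈ [n]`,
`Tr(G_{ij}G_{kl}^*) = δ_{ik}δ_{jl} n`, `G_{ij}G_{ij}^* = I_n`." (proof: `L` the addition table of `ℤ_n`,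
"a symmetric Latin square with distinct entries along the main diagonal", `V` the Vandermonde matrix
`V(k,l) = e^{−2klπi/n}`; `G_{ij}` is nonzero exactly where `L(k,l) = i`, filled with the `j`th row of
`V`, the diagonal entry getting `V(j,0) = 1` and the pairs `(k,l),(l,k)` the conjugate pairs
`V(j,t), V(j,n−t)`.) "**Theorem 38.** Suppose `n` is odd, and let `A_{n²}` be nonequality matrix of
size `n²`. Then `rank_psd(A_{n²}) ≤ n`." (proof: `X_{ij} = (I + G_{ij})/√n`, `Y_{ij} = (I − G_{ij}^*)/√n`
are psd as `‖G_{ij}‖ = 1`, and `Tr(X_{ij}Y_{kl}) = (n + Tr G_{ij} − Tr G_{kl} − Tr(G_{ij}G_{kl}^*))/n =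
1 − δ_{ik}δ_{jl}`.) "**Example 41.** [...] for odd `n`, the PSD-rank of the nonequality matrix of size
`n²` is at most `n`. This is tight by Fact 4 [...] the real PSD-rank is at least `⌈√2n − 1/2⌉` [...]
This shows a multiplicative gap of approximately `√2` between the real and complex PSD-rank."

## Contents

* `lwdwG i j` (`i, j ∈ ℤ_n`) — Lemma 37's matrices, in closed form
  `G_{ij}(a,b) = [a + b = i]·ψ(j(a − i/2))`, `ψ(x) = e^{2πix/n}` (`ZMod.stdAddChar`), `i/2 = i·(n+1)/2`
  (`n` odd): the conjugate-pair bookkeeping of the printed proof is the identity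
  `(a − i/2) + (b − i/2) = 0` on the support. `lwdwG_conjTranspose` (Hermitian), `lwdwG_mul_self`
  (`G² = I`), `trace_lwdwG` (`= 1`), `trace_lwdwG_mul` (`Tr(G_{ij}G_{kl}) = nδ`, by the orthogonality
  of the Fourier characters `AddChar.sum_mulShift`) — **Lemma 37**.
* `hasComplexPsdFactorization_nonequality_pairs(_smul)` and **`LeeWeiDeWolf2017_thm38`** —
  **Theorem 38**: `rank_psd^ℂ(D_{n²}) ≤ n` for odd `n` (`X = I + G`, `Y = I − G`, psd because
  `(I ± G)² = 2(I ± G)` for a Hermitian involution — no spectral norm needed; the overall factor `1/n`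
  by `HasComplexPsdFactorization.smul`; `Fin (n²) ≃ ℤ_n × ℤ_n` arbitrary).
* **`LeeWeiDeWolf2017_ex41`** — Example 41: for odd `n ≥ 3` the complex psd rank of `D_{n²}` is
  exactly `n` (`≥ n` from `rank D_{n²} = n²`, `HasComplexPsdFactorization.rank_le_sq`), while a real
  factorization of size `k ≥ 1` needs `n² ≤ C(k+1,2)` (`FawziEtAl2015_ex51_holds`), i.e.
  `k ≳ √2·n`.
* Appended section (2026-08-28, g19) **Lemma 39 / Theorem 40** (even `n`, `A_{n²−1}`): see the second
  module docstring below — the printed class `i = 0` (`diag(V_j)`) is NOT Hermitian (SCOPE NOTE); repaired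
  with a Hadamard matrix of order `n`, which is also necessary for a diagonal class
  (`LeeWeiDeWolf2017_lemma39_diagonal_obstruction`); `LeeWeiDeWolf2017_lemma39_of_hadamard`,
  **`LeeWeiDeWolf2017_thm40_of_hadamard`** (Hadamard orders), `_two_pow`, `_of_four_dvd_le` (`4 ∣ n ≤ 32`),
  `_two` (`A_3`); the case `n ≡ 2 (mod 4)`, `n ≥ 6` is left open (not typed as a fact).
-/

noncomputable section

open Matrix Finset

open scoped MatrixOrder ComplexOrder

namespace Literature.Combinatorics.Optimization

section Nonequality

variable {n : ℕ} [NeZero n]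

/-- `2⁻¹ = (n+1)/2` in `ℤ_n` for odd `n`. [cite: LeeWeiDeWolf2017, Lemma 37 proof (p12)] -/
private def tinv (n : ℕ) : ZMod n := (((n + 1) / 2 : ℕ) : ZMod n)

omit [NeZero n] in
/-- `2 · (n+1)/2 = 1` in `ℤ_n` for odd `n`. [folklore] -/
private theorem two_mul_tinv (hn : Odd n) : (2 : ZMod n) * tinv n = 1 := by
  obtain ⟨m, hm⟩ := hn
  have h : (n + 1) / 2 = m + 1 := by omega
  rw [tinv, h, show (2 : ZMod n) = ((2 : ℕ) : ZMod n) by norm_num, ← Nat.cast_mul,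
    show 2 * (m + 1) = n + 1 by omega, Nat.cast_add, ZMod.natCast_self, zero_add, Nat.cast_one]

/-- The additive character `ψ(x) = e^{2πix/n}` of `ℤ_n` (rows of the Fourier/Vandermonde matrix).
[cite: LeeWeiDeWolf2017, Lemma 37 proof (p12, the Vandermonde matrix V)] -/
private def ψn (n : ℕ) [NeZero n] : AddChar (ZMod n) ℂ := ZMod.stdAddChar

/-- `ψ(0) = 1`. [folklore] -/
private theorem ψn_zero : ψn n 0 = 1 := AddChar.map_zero_eq_one _

/-- `ψ(x+y) = ψ(x)ψ(y)`. [folklore] -/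
private theorem ψn_add (x y : ZMod n) : ψn n (x + y) = ψn n x * ψn n y := AddChar.map_add_eq_mul _ _ _

/-- `ψ(−x) = conj ψ(x)`. [folklore] -/
private theorem ψn_neg (x : ZMod n) : ψn n (-x) = (starRingEnd ℂ) (ψn n x) := AddChar.map_neg_eq_conj _ _

/-- `|ψ(x)| = 1`. [folklore] -/
private theorem normSq_ψn (x : ZMod n) : Complex.normSq (ψn n x) = 1 := by
  rw [ψn, ZMod.stdAddChar_apply]; exact Circle.normSq_coe _

/-- `ψ(x) conj ψ(x) = 1`. [folklore] -/
private theorem ψn_mul_conj (x : ZMod n) : ψn n x * (starRingEnd ℂ) (ψn n x) = 1 := by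
  rw [Complex.mul_conj, normSq_ψn, Complex.ofReal_one]

/-- Orthogonality of the Fourier rows: `Σ_a ψ(c·a) = n [c = 0]`. [folklore] -/
private theorem sum_ψn_mul (c : ZMod n) : ∑ a : ZMod n, ψn n (c * a) = if c = 0 then (n : ℂ) else 0 := by
  have h := AddChar.sum_mulShift c (ZMod.isPrimitive_stdAddChar n)
  simp only [ZMod.card] at h
  rw [show (fun a : ZMod n => ψn n (c * a)) = fun a => (ZMod.stdAddChar : AddChar (ZMod n) ℂ) (a * c) from
    funext fun a => by rw [mul_comm]; rfl]
  rw [h]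
  split_ifs <;> simp

/-- The matrices `G_{ij}` of Lemma 37: supported on the positions `a + b = i` of the addition table
of `ℤ_n` (a symmetric Latin square with distinct diagonal entries), filled with the `j`-th Fourier
row so as to be Hermitian: `G_{ij}(a,b) = [a + b = i] ψ(j(a − i/2))`, `ψ(x) = e^{2πix/n}`.
[cite: LeeWeiDeWolf2017, Lemma 37 (p12)] -/
def lwdwG (i j : ZMod n) : Matrix (ZMod n) (ZMod n) ℂ :=
  Matrix.of fun a b => if a + b = i then (ZMod.stdAddChar : AddChar (ZMod n) ℂ) (j * (a - i * tinv n)) else 0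

/-- Entries of `G_{ij}`. [folklore] -/
private theorem lwdwG_apply (i j a b : ZMod n) :
    lwdwG i j a b = if a + b = i then ψn n (j * (a - i * tinv n)) else 0 := rfl

/-- `G_{ij}` is Hermitian (the conjugate pair `V(j,t), V(j,n−t)` sits at `(a,b), (b,a)`).
[cite: LeeWeiDeWolf2017, Lemma 37 (p12)] -/
theorem lwdwG_conjTranspose (hn : Odd n) (i j : ZMod n) : (lwdwG i j)ᴴ = lwdwG i j := by
  ext a b
  rw [conjTranspose_apply, lwdwG_apply, lwdwG_apply]
  by_cases h : a + b = i
  · have h' : b + a = i := by rw [add_comm]; exact h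
    rw [if_pos h', if_pos h, Complex.star_def, ← ψn_neg]
    congr 1
    have h2 := two_mul_tinv hn
    have hb : b = i - a := by rw [← h]; ring
    rw [hb]
    linear_combination (j * i) * h2
  · have h' : ¬ b + a = i := by rw [add_comm]; exact h
    rw [if_neg h', if_neg h, star_zero]

/-- `G_{ij}² = I` ("`G_{ij}G_{ij}^* = I_n`": a unimodular generalized permutation matrix).
[cite: LeeWeiDeWolf2017, Lemma 37 (p12)] -/
theorem lwdwG_mul_self (hn : Odd n) (i j : ZMod n) : lwdwG i j * lwdwG i j = 1 := by
  ext a c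
  rw [Matrix.mul_apply, Finset.sum_eq_single (i - a)]
  · rw [lwdwG_apply, lwdwG_apply, if_pos (by ring), Matrix.one_apply]
    by_cases hac : a = c
    · subst hac
      rw [if_pos (by ring), if_pos rfl, ← ψn_add, ← ψn_zero (n := n)]
      congr 1
      have h2 := two_mul_tinv hn
      linear_combination (-(j * i)) * h2
    · rw [if_neg (fun h => hac (by have := h; linear_combination -this)), mul_zero, if_neg hac]
  · intro b _ hb
    rw [lwdwG_apply, if_neg (fun h => hb (by rw [← h]; ring)), zero_mul]
  · intro h; exact absurd (Finset.mem_univ _) h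

/-- `Tr G_{ij} = 1` (exactly one diagonal position, `a = i/2`, carrying `V(j,0) = 1`).
[cite: LeeWeiDeWolf2017, Lemma 37 (p12)] -/
theorem trace_lwdwG (hn : Odd n) (i j : ZMod n) : (lwdwG i j).trace = 1 := by
  have h2 := two_mul_tinv hn
  simp only [Matrix.trace, Matrix.diag_apply]
  rw [Finset.sum_eq_single (i * tinv n)]
  · rw [lwdwG_apply, if_pos (by linear_combination i * h2), sub_self, mul_zero, ψn_zero]
  · intro a _ ha
    rw [lwdwG_apply, if_neg]
    intro h
    apply ha
    linear_combination tinv n * h - a * h2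
  · intro h; exact absurd (Finset.mem_univ _) h

/-- `Tr(G_{ij} G_{kl}) = n·[ (i,j) = (k,l) ]` (disjoint supports for `i ≠ k`; for `i = k` the sum
`Σ_t V(j,t) V̄(l,t) = n δ_{jl}`). [cite: LeeWeiDeWolf2017, Lemma 37 (p12)] -/
theorem trace_lwdwG_mul (hn : Odd n) (i j k l : ZMod n) :
    (lwdwG i j * lwdwG k l).trace = if i = k ∧ j = l then (n : ℂ) else 0 := by
  have h2 := two_mul_tinv hn
  simp only [Matrix.trace, Matrix.diag_apply, Matrix.mul_apply]
  by_cases hik : i = k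
  · subst hik
    -- only `b = i − a` contributes
    have hinner : ∀ a, ∑ b, lwdwG i j a b * lwdwG i l b a = ψn n ((j - l) * (a - i * tinv n)) := by
      intro a
      rw [Finset.sum_eq_single (i - a)]
      · rw [lwdwG_apply, lwdwG_apply, if_pos (by ring), if_pos (by ring)]
        have e : l * (i - a - i * tinv n) = -(l * (a - i * tinv n)) := by
          linear_combination (-(l * i)) * h2
        rw [e, ← ψn_add]
        congr 1
        ring
      · intro b _ hb
        rw [lwdwG_apply, if_neg (fun h => hb (by rw [← h]; ring)), zero_mul]
      · intro h; exact absurd (Finset.mem_univ _) h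
    simp_rw [hinner]
    rw [show (∑ a, ψn n ((j - l) * (a - i * tinv n))) = ∑ a, ψn n ((j - l) * a) from
      Fintype.sum_equiv (Equiv.subRight (i * tinv n)) _ _ fun a => rfl]
    rw [sum_ψn_mul]
    by_cases hjl : j = l
    · subst hjl; simp
    · rw [if_neg (sub_ne_zero.mpr hjl), if_neg (fun h => hjl h.2)]
  · rw [if_neg (fun h => hik h.1)]
    refine Finset.sum_eq_zero fun a _ => Finset.sum_eq_zero fun b _ => ?_
    rw [lwdwG_apply, lwdwG_apply]
    by_cases h : a + b = i
    · have hk : ¬ b + a = k := by rw [add_comm, h]; exact hik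
      rw [if_pos h, if_neg hk, mul_zero]
    · rw [if_neg h, zero_mul]

/-- `I + εG` is psd for a Hermitian involution `G` and `ε = ±1` (`(I + εG)² = 2(I + εG)`, so
`I + εG = ½ (I + εG)ᴴ(I + εG)`; the source: "the spectral norm of each `G_{ij}` is 1, so `X_{ij}` and
`Y_{ij}` are PSD"). [cite: LeeWeiDeWolf2017, Thm. 38 proof (p12)] -/
private theorem posSemidef_one_add_of_involution {G : Matrix (ZMod n) (ZMod n) ℂ} (hG : Gᴴ = G)
    (hGG : G * G = 1) (ε : ℂ) (hε : ε = 1 ∨ ε = -1) : (1 + ε • G).PosSemidef := by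
  have hεε : ε * ε = 1 := by rcases hε with rfl | rfl <;> norm_num
  have hsq : (1 + ε • G) * (1 + ε • G) = (2 : ℂ) • (1 + ε • G) := by
    rw [add_mul, one_mul, mul_add, mul_one, Matrix.smul_mul, Matrix.mul_smul, hGG, smul_smul, hεε,
      one_smul, two_smul]
    abel
  have hH : (1 + ε • G)ᴴ = 1 + ε • G := by
    have hεr : star ε = ε := by rcases hε with rfl | rfl <;> simp
    rw [conjTranspose_add, conjTranspose_one, conjTranspose_smul, hG, hεr]
  have h : 1 + ε • G = ((1 / 2 : ℝ) : ℂ) • ((1 + ε • G)ᴴ * (1 + ε • G)) := by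
    rw [hH, hsq, smul_smul]
    norm_num
  rw [h]
  exact (posSemidef_conjTranspose_mul_self _).smul (Complex.zero_le_real.mpr (by norm_num))

/-- `I + G ⪰ 0`. [cite: LeeWeiDeWolf2017, Thm. 38 proof (p12)] -/
private theorem posSemidef_one_add {G : Matrix (ZMod n) (ZMod n) ℂ} (hG : Gᴴ = G) (hGG : G * G = 1) :
    (1 + G).PosSemidef := by
  simpa using posSemidef_one_add_of_involution hG hGG 1 (Or.inl rfl)

/-- `I − G ⪰ 0`. [cite: LeeWeiDeWolf2017, Thm. 38 proof (p12)] -/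
private theorem posSemidef_one_sub {G : Matrix (ZMod n) (ZMod n) ℂ} (hG : Gᴴ = G) (hGG : G * G = 1) :
    (1 - G).PosSemidef := by
  simpa [sub_eq_add_neg] using posSemidef_one_add_of_involution hG hGG (-1) (Or.inr rfl)

/-- **LWdW Theorem 38, for the pair-indexed nonequality matrix, scaled by `n`**: with
`X_{ij} = I + G_{ij}`, `Y_{kl} = I − G_{kl}` (psd): `Tr(X_{ij}Y_{kl}) = n + 1 − 1 − nδ = n(1 − δ)`.
[cite: LeeWeiDeWolf2017, Thm. 38 (p12)] -/
theorem hasComplexPsdFactorization_nonequality_pairs_smul (hn : Odd n) :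
    HasComplexPsdFactorization
      (fun p q : ZMod n × ZMod n => (n : ℝ) * (if p = q then (0 : ℝ) else 1)) n := by
  classical
  let e : Fin n ≃ ZMod n := (ZMod.finEquiv n).toEquiv
  have htr : ∀ Z : Matrix (ZMod n) (ZMod n) ℂ, (Z.submatrix e e).trace = Z.trace := fun Z => by
    simp only [Matrix.trace, Matrix.diag_apply, Matrix.submatrix_apply]
    exact Fintype.sum_equiv e _ _ fun x => rfl
  refine ⟨fun p => (1 + lwdwG p.1 p.2).submatrix e e, fun q => (1 - lwdwG q.1 q.2).submatrix e e,
    fun p => (posSemidef_one_add (lwdwG_conjTranspose hn _ _) (lwdwG_mul_self hn _ _)).submatrix e,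
    fun q => (posSemidef_one_sub (lwdwG_conjTranspose hn _ _) (lwdwG_mul_self hn _ _)).submatrix e,
    fun p q => ?_⟩
  rw [submatrix_mul_equiv, htr]
  simp only [add_mul, mul_sub, one_mul, mul_one, trace_add, trace_sub, trace_one, ZMod.card,
    trace_lwdwG hn, trace_lwdwG_mul hn]
  by_cases hpq : p = q
  · subst hpq
    simp only [and_self, if_true, mul_zero, Complex.ofReal_zero]
    ring
  · have : ¬ (p.1 = q.1 ∧ p.2 = q.2) := fun h => hpq (Prod.ext h.1 h.2)
    rw [if_neg this, if_neg hpq]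
    push_cast
    ring

/-- **LWdW Theorem 38, pair-indexed form**: the `n² × n²` nonequality matrix
`NE((i,j),(k,l)) = [ (i,j) ≠ (k,l) ]` has a complex psd factorization of size `n` for odd `n`.
[cite: LeeWeiDeWolf2017, Thm. 38 (p12)] -/
theorem hasComplexPsdFactorization_nonequality_pairs (hn : Odd n) :
    HasComplexPsdFactorization (fun p q : ZMod n × ZMod n => if p = q then (0 : ℝ) else 1) n := by
  have h := (hasComplexPsdFactorization_nonequality_pairs_smul hn).smul
    (c := 1 / n) (by positivity)
  have hn0 : (n : ℝ) ≠ 0 := by exact_mod_cast NeZero.ne n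
  convert h using 2 with p q
  field_simp

/-- **LWdW Theorem 38** (p12, verbatim: "Suppose `n` is odd, and let `A_{n²}` be nonequality matrix of
size `n²`. Then `rank_psd(A_{n²}) ≤ n`"): the `n² × n²` nonequality (= derangement) matrix
`[x ≠ y]` has a complex psd factorization of size `n` — Lemma 37's Hermitian unimodular
generalized permutation matrices `G_{ij}` on the addition table of `ℤ_n` with Fourier rows
(`lwdwG`: `Tr G_{ij} = 1`, `Tr(G_{ij}G_{kl}) = nδ`, `G² = I`), `X_{ij} = I + G_{ij}`, `Y_{kl} = I − G_{kl}`
(here scaled by `1/n` instead of `1/√n` each). The tree's `derangementMatrix (n^2)` is reached by an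
arbitrary bijection `Fin (n²) ≃ ℤ_n × ℤ_n`. [cite: LeeWeiDeWolf2017, Thm. 38 (p12)] -/
theorem LeeWeiDeWolf2017_thm38 (hn : Odd n) : HasComplexPsdFactorization (derangementMatrix (n ^ 2)) n := by
  classical
  have hcard : Fintype.card (Fin (n ^ 2)) = Fintype.card (ZMod n × ZMod n) := by
    simp [ZMod.card, sq]
  let e : Fin (n ^ 2) ≃ ZMod n × ZMod n := Fintype.equivOfCardEq hcard
  have h := (hasComplexPsdFactorization_nonequality_pairs hn).submatrix e e
  have heq : (fun i j => if e i = e j then (0 : ℝ) else 1) =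
      (derangementMatrix (n ^ 2) : Fin (n ^ 2) → Fin (n ^ 2) → ℝ) := by
    funext i j
    simp [e.injective.eq_iff]
  rw [heq] at h
  exact h

/-- **LWdW Example 41** (p12: "for odd `n`, the PSD-rank of the nonequality matrix of size `n²` is at
most `n`. This is tight by Fact 4, since the rank of the nonequality matrix of this size is `n²`. On
the other hand [...] the real PSD-rank is at least `⌈√2 n − 1/2⌉` [...] a multiplicative gap of
approximately `√2` between the real and complex PSD-rank"): for odd `n ≥ 3`, the complex psd rank of
`D_{n²}` is exactly `n`, while every real psd factorization of size `k ≥ 1` has `n² ≤ C(k+1, 2)`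
(FGPRT Example 5.1, `FawziEtAl2015_ex51_holds`). [cite: LeeWeiDeWolf2017, Ex. 41 (p12)] -/
theorem LeeWeiDeWolf2017_ex41 (hn : Odd n) (h3 : 3 ≤ n) :
    (HasComplexPsdFactorization (derangementMatrix (n ^ 2)) n ∧
      ∀ r, HasComplexPsdFactorization (derangementMatrix (n ^ 2)) r → n ≤ r) ∧
    ∀ k, 1 ≤ k → HasPsdFactorization (derangementMatrix (n ^ 2)) k → n ^ 2 ≤ (k + 1).choose 2 := by
  refine ⟨⟨LeeWeiDeWolf2017_thm38 hn, fun r hr => ?_⟩,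
    fun k hk h => (FawziEtAl2015_ex51_holds (n ^ 2) k hk).mp h⟩
  have hle := hr.rank_le_sq
  rw [rank_derangementMatrix (by nlinarith)] at hle
  by_contra hlt
  have : r + 1 ≤ n := by omega
  nlinarith

end Nonequality

end Literature.Combinatorics.Optimization

/-! ## Lemma 39 / Theorem 40: the even case `A_{n²−1}` (appended 2026-08-28)

Printed statements (p12, verbatim). "**Lemma 39.** Let `n` be even. Then there are `n²−1` Hermitian matrices
`G_{ij}` such that `Tr(G_{ij}) = Tr(G_{kl})` for all `i,j,k,l`, `Tr(G_{ij}G_{kl}^*) = δ_{ik}δ_{jl} n`,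
`G_{ij}G_{ij}^* = I_n`. *Proof.* The construction is similar. Again let `V` be the Vandermonde matrix of
roots of unity and this time let `L` be a symmetric Latin square with entries from `[n]` where the
diagonal has all entries `0`. For `i > 0`, the matrix `G_{ij}` is defined as before, with the additional
subtlety that if `j` is odd then `V(j,0) = 1` and `V(j,n/2) = −1` and instead of taking this pair we use
`(i,−i)` in the matrix. For `i = 0` we use all the rows of `V` except `V_0`, the all-one row, to ensure
that the trace of all `G_{ij}` is zero (this is why we can only create `n²−1` matrices)." "**Theorem 40.**
Suppose `n` is even, and let `A_{n²−1}` be the nonequality matrix of size `n²−1`. Then it holds that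
`rank_psd(A_{n²−1}) ≤ n`."

**SCOPE NOTE (a gap in the printed proof, and its exact repair condition).** For the class `i = 0` the
support `{L(k,l) = 0}` is the DIAGONAL, and the printed `G_{0j} = diag(V_j)`, `V(j,l) = e^{−2πi jl/n}`, is
Hermitian only for `j ∈ {0, n/2}`; for the other `j` the factor `X_{0j} = (I + G_{0j})/√n` of Theorem 40
is not Hermitian, hence not psd. What the argument needs from the class `i = 0` is `n − 1` DIAGONAL
Hermitian matrices with `G² = I`, trace `0` and `Tr(G G') = nδ` — i.e. `n − 1` pairwise orthogonal
zero-sum `±1`-vectors, which together with the all-ones vector form a HADAMARD MATRIX of order `n`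
(`LeeWeiDeWolf2017_lemma39_diagonal_obstruction`: such a diagonal family exists only if `n ≤ 2` or
`4 ∣ n`); and the classes `i > 0` (the perfect matchings of the Latin square, each carrying `n`
orthogonal unimodular fillings, which span their supports) leave no other room. Conversely a Hadamard
matrix of order `n` (row-normalized) supplies exactly this diagonal class. Accordingly Theorem 40 is
PROVED here for every even `n` that is the order of a Hadamard matrix
(`LeeWeiDeWolf2017_thm40_of_hadamard`), unconditionally for `n = 2^m`
(`LeeWeiDeWolf2017_thm40_two_pow`, Sylvester) and for `4 ∣ n ≤ 32` (`LeeWeiDeWolf2017_thm40_of_four_dvd_le`,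
Paley; both from `Literature/Combinatorics/Designs`), and for `n = 2` (`A_3`, `LeeWeiDeWolf2017_thm40_two`).
For `n ≡ 2 (mod 4)`, `n ≥ 6`, the printed construction does not exist and the statement
`rank_psd(A_{n²−1}) ≤ n` is left open here (e.g. `rank_psd(A_{35}) ∈ {6, 7}` by Fact 4 and Theorem 38 for
`A_{49}`); it is NOT typed as a fact.

Construction (classes `i > 0`, following the print with an explicit Latin square). Write `n = r + 1`,
`r` odd, vertices `ℤ_r ∪ {∞}` (`Option (ZMod r)`). The symmetric Latin square with zero diagonal is the
round-robin one-factorization of `K_n`: class `c ∈ ℤ_r` is the perfect matching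
`{k, c − k} (k ≠ c/2), {c/2, ∞}` (`lwdwPartner`). Its `n` fillings `G_{c,j}`, `j ∈ ℤ_n` (`lwdwGe`): the pair
`{c/2 + s, c/2 − s}` (`s ≠ 0`) carries the conjugate pair `ψ(∓ j s̃)`, `s̃ = valMinAbs s ∈ {±1,…,±(n/2−1)}`,
`ψ(x) = e^{2πix/n}` — the printed `V(j,t), V(j,n−t)` — and the pair `{c/2, ∞}` carries `(a_j, ā_j)` with
`a_j = 1` for even `j` and `a_j = i` for odd `j` (`lwdwSpecial`) — the printed "instead of taking this pair
we use `(i,−i)`". Then `G_{c,j}` is Hermitian with `G² = I`, trace `0`, and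
`Tr(G_{c,j}G_{c',j'}) = nδ` (`trace_lwdwGe_mul`: the exponents `valMinAbs(ℤ_r) ∪ {n/2}` are a complete
residue system mod `n`, `lwdwSlot_bijective`, and `a_j ā_{j'} + ā_j a_{j'} = 1 + (−1)^{j+j'}`).
-/

namespace Literature.Combinatorics.Optimization

section NonequalityEven

open Literature.Combinatorics.Designs.GoethalsSeidel (IsHadamardMatrix)
open Literature.Combinatorics.Designs.HadamardDesign (normalizeRow isHadamardMatrix_normalizeRow sum_mul_eq
  mul_self_entry)

variable {r : ℕ} [NeZero r]

/-! ### The special pair `(1,1)` / `(i,−i)` -/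

/-- `n/2 ∈ ℤ_n` (`n = r + 1` even). [cite: LeeWeiDeWolf2017, Lemma 39 proof (p12, "V(j,n/2) = −1")] -/
def lwdwHalf (r : ℕ) : ZMod (r + 1) := (((r + 1) / 2 : ℕ) : ZMod (r + 1))

omit [NeZero r] in
/-- `2·(n/2) = 0` in `ℤ_n` for `n = r + 1`, `r` odd. [folklore] -/
private theorem two_mul_lwdwHalf (hr : Odd r) : (2 : ZMod (r + 1)) * lwdwHalf r = 0 := by
  obtain ⟨m, rfl⟩ := hr
  rw [lwdwHalf, show (2 * m + 1 + 1) / 2 = m + 1 by omega,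
    show (2 : ZMod (2 * m + 1 + 1)) = ((2 : ℕ) : ZMod (2 * m + 1 + 1)) by norm_num, ← Nat.cast_mul,
    show 2 * (m + 1) = 2 * m + 1 + 1 by ring, ZMod.natCast_self]

/-- `ε_j = V(j, n/2) = (−1)^j`. [cite: LeeWeiDeWolf2017, Lemma 39 proof (p12)] -/
private def εe (r : ℕ) (j : ZMod (r + 1)) : ℂ := ψn (r + 1) (j * lwdwHalf r)

omit [NeZero r] in
/-- `ε_j² = 1`. [folklore] -/
private theorem εe_mul_εe (hr : Odd r) (j : ZMod (r + 1)) : εe r j * εe r j = 1 := by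
  rw [εe, ← ψn_add, ← ψn_zero (n := r + 1)]
  congr 1
  have h := two_mul_lwdwHalf hr
  linear_combination j * h

omit [NeZero r] in
/-- `ε_j = ±1`. [folklore] -/
private theorem εe_eq (hr : Odd r) (j : ZMod (r + 1)) : εe r j = 1 ∨ εe r j = -1 :=
  mul_self_eq_one_iff.mp (εe_mul_εe hr j)

omit [NeZero r] in
/-- `ε_j` is real. [folklore] -/
private theorem conj_εe (hr : Odd r) (j : ZMod (r + 1)) : (starRingEnd ℂ) (εe r j) = εe r j := by
  rcases εe_eq hr j with h | h <;> rw [h] <;> simp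

omit [NeZero r] in
/-- `V(j − j', n/2) = ε_j ε_{j'}`. [folklore] -/
private theorem ψn_sub_mul_lwdwHalf (hr : Odd r) (j j' : ZMod (r + 1)) :
    ψn (r + 1) ((j - j') * lwdwHalf r) = εe r j * εe r j' := by
  rw [sub_mul, sub_eq_add_neg, ψn_add, ψn_neg, ← εe, ← εe, conj_εe hr]

/-- The entry `a_j` of the special pair `{c/2, ∞}`: `a_j = 1` for even `j` and `a_j = i` for odd `j`
("if `j` is odd then `V(j,0) = 1` and `V(j,n/2) = −1` and instead of taking this pair we use `(i,−i)`"),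
written as `((1 + ε_j) + i(1 − ε_j))/2`, `ε_j = (−1)^j`. [cite: LeeWeiDeWolf2017, Lemma 39 proof (p12)] -/
def lwdwSpecial (r : ℕ) (j : ZMod (r + 1)) : ℂ :=
  ((1 + (ZMod.stdAddChar : AddChar (ZMod (r + 1)) ℂ) (j * lwdwHalf r)) +
    Complex.I * (1 - (ZMod.stdAddChar : AddChar (ZMod (r + 1)) ℂ) (j * lwdwHalf r))) / 2

omit [NeZero r] in
/-- Unfolding. [folklore] -/
private theorem lwdwSpecial_eq (j : ZMod (r + 1)) :
    lwdwSpecial r j = ((1 + εe r j) + Complex.I * (1 - εe r j)) / 2 := rfl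

omit [NeZero r] in
/-- `ā_j`. [folklore] -/
private theorem conj_lwdwSpecial (hr : Odd r) (j : ZMod (r + 1)) :
    (starRingEnd ℂ) (lwdwSpecial r j) = ((1 + εe r j) - Complex.I * (1 - εe r j)) / 2 := by
  rw [lwdwSpecial_eq, map_div₀, map_add, map_add, map_mul, map_sub, map_one, Complex.conj_I, conj_εe hr,
    map_ofNat]
  ring

omit [NeZero r] in
/-- `|a_j| = 1`. [folklore] -/
private theorem lwdwSpecial_mul_conj (hr : Odd r) (j : ZMod (r + 1)) :
    lwdwSpecial r j * (starRingEnd ℂ) (lwdwSpecial r j) = 1 := by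
  rw [conj_lwdwSpecial hr, lwdwSpecial_eq]
  have h := εe_mul_εe hr j
  have hI : Complex.I * Complex.I = -1 := Complex.I_mul_I
  linear_combination (1 / 2 : ℂ) * h - ((1 - εe r j) ^ 2 / 4) * hI

omit [NeZero r] in
/-- `a_j ā_{j'} + ā_j a_{j'} = 1 + ε_j ε_{j'}` (`= V(j−j',0) + V(j−j',n/2)`: the special pair contributes to
`Tr(G_{c,j}G_{c,j'})` exactly what the printed pair `V(j,0), V(j,n/2)` would).
[cite: LeeWeiDeWolf2017, Lemma 39 proof (p12)] -/
private theorem lwdwSpecial_conj_add (hr : Odd r) (j j' : ZMod (r + 1)) :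
    lwdwSpecial r j * (starRingEnd ℂ) (lwdwSpecial r j') +
        (starRingEnd ℂ) (lwdwSpecial r j) * lwdwSpecial r j' = 1 + εe r j * εe r j' := by
  rw [conj_lwdwSpecial hr, conj_lwdwSpecial hr, lwdwSpecial_eq, lwdwSpecial_eq]
  have hI : Complex.I * Complex.I = -1 := Complex.I_mul_I
  linear_combination (-(1 - εe r j) * (1 - εe r j') / 2) * hI

/-! ### The exponents: `valMinAbs(ℤ_r) ∪ {n/2}` is a complete residue system mod `n` -/

/-- The exponent slots of the vertices: `s ∈ ℤ_r ↦ s̃ = valMinAbs s ∈ {0, ±1, …, ±(n/2 − 1)}` and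
`∞ ↦ n/2`, as elements of `ℤ_n`. [cite: LeeWeiDeWolf2017, Lemma 39 proof (p12, the pairs V(j,t), V(j,n−t))] -/
def lwdwSlot (r : ℕ) : Option (ZMod r) → ZMod (r + 1)
  | some s => ((s.valMinAbs : ℤ) : ZMod (r + 1))
  | none => lwdwHalf r

/-- The slots are pairwise distinct mod `n` (the exponents `0, ±1, …, ±(n/2−1), n/2` of the printed pairs
`V(j,t), V(j,n−t)` and of `V(j,0), V(j,n/2)`). [cite: LeeWeiDeWolf2017, Lemma 39 proof (p12)] -/
theorem lwdwSlot_injective (hr : Odd r) : Function.Injective (lwdwSlot r) := by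
  obtain ⟨m, hm⟩ := hr
  have hb : ∀ s : ZMod r, -(m : ℤ) ≤ s.valMinAbs ∧ s.valMinAbs ≤ m := fun s => by
    have h := s.natAbs_valMinAbs_le
    have hr2 : r / 2 = m := by omega
    rw [hr2] at h
    constructor <;> omega
  have hN : ((r + 1 : ℕ) : ℤ) = 2 * m + 2 := by omega
  have hh : (((r + 1) / 2 : ℕ) : ℤ) = m + 1 := by omega
  have hhalf : lwdwHalf r = ((((r + 1) / 2 : ℕ) : ℤ) : ZMod (r + 1)) := by rw [lwdwHalf, Int.cast_natCast]
  intro x y hxy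
  cases x with
  | none =>
    cases y with
    | none => rfl
    | some t =>
      exfalso
      simp only [lwdwSlot, hhalf] at hxy
      rw [ZMod.intCast_eq_intCast_iff_dvd_sub, hN, hh] at hxy
      have ht := hb t
      have h0 := Int.eq_zero_of_abs_lt_dvd hxy (abs_lt.mpr ⟨by omega, by omega⟩)
      omega
  | some s =>
    cases y with
    | none =>
      exfalso
      simp only [lwdwSlot, hhalf] at hxy
      rw [ZMod.intCast_eq_intCast_iff_dvd_sub, hN, hh] at hxy
      have hs := hb s
      have h0 := Int.eq_zero_of_abs_lt_dvd hxy (abs_lt.mpr ⟨by omega, by omega⟩)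
      omega
    | some t =>
      simp only [lwdwSlot] at hxy
      rw [ZMod.intCast_eq_intCast_iff_dvd_sub, hN] at hxy
      have hs := hb s
      have ht := hb t
      have h0 := Int.eq_zero_of_abs_lt_dvd hxy (abs_lt.mpr ⟨by omega, by omega⟩)
      have hv : s.valMinAbs = t.valMinAbs := by omega
      rw [← ZMod.coe_valMinAbs s, ← ZMod.coe_valMinAbs t, hv]

/-- Hence a bijection `ℤ_r ∪ {∞} ≃ ℤ_n` (every column of `V` is used exactly once per `G_{ij}`).
[cite: LeeWeiDeWolf2017, Lemma 39 proof (p12)] -/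
theorem lwdwSlot_bijective (hr : Odd r) : Function.Bijective (lwdwSlot r) :=
  (Fintype.bijective_iff_injective_and_card _).mpr
    ⟨lwdwSlot_injective hr, by simp [Fintype.card_option, ZMod.card]⟩

/-- Splitting the orthogonality relation of the Fourier rows along the slots:
`Σ_{s ∈ ℤ_r} ψ(d·s̃) = n[d = 0] − ψ(d·n/2)`. [folklore] -/
private theorem sum_ψn_slot (hr : Odd r) (d : ZMod (r + 1)) :
    ∑ s : ZMod r, ψn (r + 1) (d * ((s.valMinAbs : ℤ) : ZMod (r + 1))) =
      (if d = 0 then ((r + 1 : ℕ) : ℂ) else 0) - ψn (r + 1) (d * lwdwHalf r) := by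
  have h' := (lwdwSlot_bijective hr).sum_comp (fun t => ψn (r + 1) (d * t))
  simp only [Fintype.sum_option, lwdwSlot] at h'
  rw [sum_ψn_mul] at h'
  rw [← h']
  ring

/-! ### The one-factorization (symmetric Latin square with zero diagonal) -/

/-- The partner of a vertex in the perfect matching of class `c ∈ ℤ_r` (round-robin schedule on
`ℤ_r ∪ {∞}`): `k ↦ c − k` for `k ≠ c/2`, `c/2 ↦ ∞`, `∞ ↦ c/2` — the positions `L(x,y) = c` of a symmetric
Latin square with zero diagonal. [cite: LeeWeiDeWolf2017, Lemma 39 proof (p12, "a symmetric Latin square …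
where the diagonal has all entries 0")] -/
def lwdwPartner (c : ZMod r) : Option (ZMod r) → Option (ZMod r)
  | some k => if k = c * tinv r then none else some (c - k)
  | none => some (c * tinv r)

omit [NeZero r] in
/-- `c − c/2 = c/2`. [folklore] -/
private theorem sub_half (hr : Odd r) (c : ZMod r) : c - c * tinv r = c * tinv r := by
  have h := two_mul_tinv hr
  linear_combination (-c) * h

omit [NeZero r] in
/-- The matching is an involution (`L` symmetric). [cite: LeeWeiDeWolf2017, Lemma 39 proof (p12, "symmetric Latin square")] -/
theorem lwdwPartner_lwdwPartner (hr : Odd r) (c : ZMod r) (x : Option (ZMod r)) :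
    lwdwPartner c (lwdwPartner c x) = x := by
  cases x with
  | none => simp [lwdwPartner]
  | some k =>
    by_cases hk : k = c * tinv r
    · simp [lwdwPartner, hk]
    · have hk' : ¬ c - k = c * tinv r := fun h => hk (by rw [← sub_half hr c, ← h]; ring)
      simp [lwdwPartner, hk, hk']

omit [NeZero r] in
/-- The matching has no fixed point (`L` has zero diagonal). [cite: LeeWeiDeWolf2017, Lemma 39 proof (p12, "the diagonal has all entries 0")] -/
theorem lwdwPartner_ne_self (hr : Odd r) (c : ZMod r) (x : Option (ZMod r)) : lwdwPartner c x ≠ x := by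
  cases x with
  | none => simp [lwdwPartner]
  | some k =>
    by_cases hk : k = c * tinv r
    · simp [lwdwPartner, hk]
    · simp only [lwdwPartner, if_neg hk, ne_eq, Option.some.injEq]
      intro h
      apply hk
      have h2 := two_mul_tinv hr
      have hc : c = 2 * k := by linear_combination h
      rw [hc]
      linear_combination (-k) * h2

omit [NeZero r] in
/-- Different classes have disjoint matchings (`L` is a Latin square: each row is a permutation).
[cite: LeeWeiDeWolf2017, Lemma 39 proof (p12, "Latin square")] -/
theorem eq_of_lwdwPartner_eq (hr : Odd r) {c c' : ZMod r} {x : Option (ZMod r)}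
    (h : lwdwPartner c x = lwdwPartner c' x) : c = c' := by
  have h2 := two_mul_tinv hr
  cases x with
  | none =>
    simp only [lwdwPartner, Option.some.injEq] at h
    linear_combination (2 : ZMod r) * h - c * h2 + c' * h2
  | some k =>
    by_cases hk : k = c * tinv r
    · by_cases hk' : k = c' * tinv r
      · rw [hk] at hk'
        linear_combination (2 : ZMod r) * hk' - c * h2 + c' * h2
      · simp only [lwdwPartner, if_pos hk, if_neg hk'] at h
        cases h
    · by_cases hk' : k = c' * tinv r
      · simp only [lwdwPartner, if_neg hk, if_pos hk'] at h
        cases h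
      · simp only [lwdwPartner, if_neg hk, if_neg hk', Option.some.injEq] at h
        linear_combination h

/-! ### The matrices `G_{c,j}` of the classes `i > 0` -/

/-- The nonzero entry of `G_{c,j}` in row `x` (at column `lwdwPartner c x`): `ψ(j·s̃)` at `x = c/2 + s`
(`s ≠ 0`), `a_j` at `x = c/2`, `ā_j` at `x = ∞`. [cite: LeeWeiDeWolf2017, Lemma 39 proof (p12)] -/
def lwdwFill (c : ZMod r) (j : ZMod (r + 1)) : Option (ZMod r) → ℂ
  | some k => if k = c * tinv r then lwdwSpecial r j
      else (ZMod.stdAddChar : AddChar (ZMod (r + 1)) ℂ) (j * (((k - c * tinv r).valMinAbs : ℤ) : ZMod (r + 1)))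
  | none => (starRingEnd ℂ) (lwdwSpecial r j)

/-- **The matrices `G_{ij}` of Lemma 39 for `i > 0`**: `G_{c,j}(x,y) = [y = partner_c(x)]·fill_{c,j}(x)`.
[cite: LeeWeiDeWolf2017, Lemma 39 (p12)] -/
def lwdwGe (c : ZMod r) (j : ZMod (r + 1)) : Matrix (Option (ZMod r)) (Option (ZMod r)) ℂ :=
  Matrix.of fun x y => if y = lwdwPartner c x then lwdwFill c j x else 0

omit [NeZero r] in
/-- Entries. [folklore] -/
private theorem lwdwGe_apply (c : ZMod r) (j : ZMod (r + 1)) (x y : Option (ZMod r)) :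
    lwdwGe c j x y = if y = lwdwPartner c x then lwdwFill c j x else 0 := rfl

omit [NeZero r] in
/-- The filling is Hermitian along the matching: `fill(partner x) = conj (fill x)` (the conjugate pairs
`V(j,t), V(j,n−t)` and `(a_j, ā_j)`). [cite: LeeWeiDeWolf2017, Lemma 39 proof (p12)] -/
theorem lwdwFill_lwdwPartner (hr : Odd r) (c : ZMod r) (j : ZMod (r + 1)) (x : Option (ZMod r)) :
    lwdwFill c j (lwdwPartner c x) = (starRingEnd ℂ) (lwdwFill c j x) := by
  cases x with
  | none => simp [lwdwPartner, lwdwFill]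
  | some k =>
    by_cases hk : k = c * tinv r
    · simp [lwdwPartner, lwdwFill, hk]
    · have hk' : ¬ c - k = c * tinv r := fun h => hk (by rw [← sub_half hr c, ← h]; ring)
      simp only [lwdwPartner, lwdwFill, if_neg hk, if_neg hk']
      have hneg : c - k - c * tinv r = -(k - c * tinv r) := by
        have := sub_half hr c; linear_combination this
      have hne : 2 * (k - c * tinv r).val ≠ r := by
        intro h; obtain ⟨m, hm⟩ := hr; omega
      rw [hneg, ZMod.valMinAbs_neg_of_ne_half hne, Int.cast_neg, mul_neg]
      exact ψn_neg (n := r + 1) _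

omit [NeZero r] in
/-- The filling is unimodular. [cite: LeeWeiDeWolf2017, Lemma 39 proof (p12, "entries are roots of unity")] -/
theorem lwdwFill_mul_conj (hr : Odd r) (c : ZMod r) (j : ZMod (r + 1)) (x : Option (ZMod r)) :
    lwdwFill c j x * (starRingEnd ℂ) (lwdwFill c j x) = 1 := by
  cases x with
  | none => simp only [lwdwFill, Complex.conj_conj]; rw [mul_comm]; exact lwdwSpecial_mul_conj hr j
  | some k =>
    by_cases hk : k = c * tinv r
    · simp only [lwdwFill, if_pos hk]; exact lwdwSpecial_mul_conj hr j
    · simp only [lwdwFill, if_neg hk]; exact ψn_mul_conj (n := r + 1) _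

omit [NeZero r] in
/-- **`G_{c,j}` is Hermitian.** [cite: LeeWeiDeWolf2017, Lemma 39 (p12)] -/
theorem lwdwGe_conjTranspose (hr : Odd r) (c : ZMod r) (j : ZMod (r + 1)) : (lwdwGe c j)ᴴ = lwdwGe c j := by
  ext x y
  rw [conjTranspose_apply, lwdwGe_apply, lwdwGe_apply]
  by_cases h : y = lwdwPartner c x
  · have h' : x = lwdwPartner c y := by rw [h, lwdwPartner_lwdwPartner hr]
    rw [if_pos h', if_pos h, h', lwdwFill_lwdwPartner hr, Complex.star_def]
  · have h' : ¬ x = lwdwPartner c y := fun h' => h (by rw [h', lwdwPartner_lwdwPartner hr])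
    rw [if_neg h', if_neg h, star_zero]

/-- **`G_{c,j} G_{c,j}^* = I`** (`G² = I`: a unimodular generalized permutation matrix on an involution).
[cite: LeeWeiDeWolf2017, Lemma 39 (p12)] -/
theorem lwdwGe_mul_self (hr : Odd r) (c : ZMod r) (j : ZMod (r + 1)) : lwdwGe c j * lwdwGe c j = 1 := by
  ext x z
  rw [Matrix.mul_apply, Finset.sum_eq_single (lwdwPartner c x)]
  · rw [lwdwGe_apply, lwdwGe_apply, if_pos rfl, lwdwPartner_lwdwPartner hr, Matrix.one_apply]
    by_cases hz : z = x
    · subst hz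
      rw [if_pos rfl, if_pos rfl, lwdwFill_lwdwPartner hr, lwdwFill_mul_conj hr]
    · rw [if_neg hz, mul_zero, if_neg (Ne.symm hz)]
  · intro y _ hy
    rw [lwdwGe_apply, if_neg hy, zero_mul]
  · intro h; exact absurd (Finset.mem_univ _) h

/-- **`Tr G_{c,j} = 0`** (zero diagonal). [cite: LeeWeiDeWolf2017, Lemma 39 (p12, "the trace of all G_{ij} is zero")] -/
theorem trace_lwdwGe (hr : Odd r) (c : ZMod r) (j : ZMod (r + 1)) : (lwdwGe c j).trace = 0 := by
  simp only [Matrix.trace, Matrix.diag_apply]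
  refine Finset.sum_eq_zero fun x _ => ?_
  rw [lwdwGe_apply, if_neg (Ne.symm (lwdwPartner_ne_self hr c x))]

/-- **`Tr(G_{c,j} G_{c',j'}) = n·[(c,j) = (c',j')]`** (disjoint supports for `c ≠ c'`; for `c = c'` the sum
over the matching of `fill_j · conj fill_{j'}` is `Σ_{s ≠ 0} ψ((j−j') s̃) + a_j ā_{j'} + ā_j a_{j'} =
Σ_{t ∈ ℤ_n} ψ((j−j') t) = nδ_{jj'}`). [cite: LeeWeiDeWolf2017, Lemma 39 (p12)] -/
theorem trace_lwdwGe_mul (hr : Odd r) (c : ZMod r) (j : ZMod (r + 1)) (c' : ZMod r) (j' : ZMod (r + 1)) :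
    (lwdwGe c j * lwdwGe c' j').trace = if c = c' ∧ j = j' then ((r + 1 : ℕ) : ℂ) else 0 := by
  have h2 := two_mul_tinv hr
  simp only [Matrix.trace, Matrix.diag_apply, Matrix.mul_apply]
  have hinner : ∀ x, ∑ y, lwdwGe c j x y * lwdwGe c' j' y x =
      lwdwFill c j x * lwdwGe c' j' (lwdwPartner c x) x := by
    intro x
    rw [Finset.sum_eq_single (lwdwPartner c x)]
    · rw [lwdwGe_apply c j, if_pos rfl]
    · intro y _ hy
      rw [lwdwGe_apply, if_neg hy, zero_mul]
    · intro h; exact absurd (Finset.mem_univ _) h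
  simp_rw [hinner]
  by_cases hcc : c = c'
  · subst hcc
    have hterm : ∀ x, lwdwFill c j x * lwdwGe c j' (lwdwPartner c x) x =
        lwdwFill c j x * (starRingEnd ℂ) (lwdwFill c j' x) := by
      intro x
      rw [lwdwGe_apply, lwdwPartner_lwdwPartner hr, if_pos rfl, lwdwFill_lwdwPartner hr]
    simp_rw [hterm]
    rw [Fintype.sum_option]
    -- the `some` part, shifted to `s = k − c/2`
    have hsome : ∑ k : ZMod r, lwdwFill c j (some k) * (starRingEnd ℂ) (lwdwFill c j' (some k)) =
        ∑ s : ZMod r, (ψn (r + 1) ((j - j') * ((s.valMinAbs : ℤ) : ZMod (r + 1))) +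
          if s = 0 then lwdwSpecial r j * (starRingEnd ℂ) (lwdwSpecial r j') - 1 else 0) := by
      refine Fintype.sum_equiv (Equiv.subRight (c * tinv r)) _ _ (fun k => ?_)
      simp only [Equiv.subRight_apply, sub_eq_zero]
      by_cases hk : k = c * tinv r
      · simp only [lwdwFill, hk, sub_self, ZMod.valMinAbs_zero, Int.cast_zero, mul_zero, ψn_zero, if_true]
        ring
      · simp only [lwdwFill, if_neg hk]
        rw [add_zero]
        show ψn (r + 1) _ * (starRingEnd ℂ) (ψn (r + 1) _) = _
        rw [← ψn_neg, ← ψn_add]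
        congr 1
        ring
    rw [hsome, Finset.sum_add_distrib, Finset.sum_ite_eq' Finset.univ (0 : ZMod r), if_pos (Finset.mem_univ _),
      sum_ψn_slot hr, ψn_sub_mul_lwdwHalf hr]
    simp only [lwdwFill, Complex.conj_conj]
    have hsp := lwdwSpecial_conj_add hr j j'
    by_cases hjj : j = j'
    · subst hjj
      simp only [sub_self, if_true, and_self]
      linear_combination hsp
    · rw [if_neg (sub_ne_zero.mpr hjj), if_neg (fun h => hjj h.2)]
      linear_combination hsp
  · rw [if_neg (fun h => hcc h.1)]
    refine Finset.sum_eq_zero fun x _ => ?_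
    rw [lwdwGe_apply, if_neg, mul_zero]
    intro hx
    apply hcc
    have h1 : lwdwPartner c' x = lwdwPartner c x := by
      conv_lhs => rw [hx]
      rw [lwdwPartner_lwdwPartner hr]
    exact eq_of_lwdwPartner_eq hr h1.symm

/-! ### The class `i = 0` from a Hadamard matrix -/

/-- **The diagonal class, repaired**: for an integer matrix `B` of order `n = r + 1` (a row-normalized
Hadamard matrix in the application) and a labelling `e` of the vertices, `D_i = diag(B_{i, e(x)})`.
(The printed `diag(V_j)` is not Hermitian; see the SCOPE NOTE of this section.)
[cite: LeeWeiDeWolf2017, Lemma 39 proof (p12, "For i = 0 we use all the rows of V except V_0")] -/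
def lwdwDe (B : Matrix (Fin (r + 1)) (Fin (r + 1)) ℤ) (e : Option (ZMod r) ≃ Fin (r + 1)) (i : Fin (r + 1)) :
    Matrix (Option (ZMod r)) (Option (ZMod r)) ℂ :=
  Matrix.diagonal fun x => ((B i (e x) : ℤ) : ℂ)

omit [NeZero r] in
/-- `D_i` is Hermitian (real diagonal) — the property the printed `diag(V_j)` lacks. [cite: LeeWeiDeWolf2017, Lemma 39 (p12, "Hermitian matrices")] -/
theorem lwdwDe_conjTranspose (B : Matrix (Fin (r + 1)) (Fin (r + 1)) ℤ) (e : Option (ZMod r) ≃ Fin (r + 1))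
    (i : Fin (r + 1)) : (lwdwDe B e i)ᴴ = lwdwDe B e i := by
  rw [lwdwDe, Matrix.diagonal_conjTranspose]
  congr 1
  funext x
  exact map_intCast (starRingEnd ℂ) _

/-- `D_i D_i^* = I` for a `±1` matrix `B`. [cite: LeeWeiDeWolf2017, Lemma 39 (p12, "G_{ij}G_{ij}^* = I_n")] -/
theorem lwdwDe_mul_self {B : Matrix (Fin (r + 1)) (Fin (r + 1)) ℤ} (hB : IsHadamardMatrix B)
    (e : Option (ZMod r) ≃ Fin (r + 1)) (i : Fin (r + 1)) : lwdwDe B e i * lwdwDe B e i = 1 := by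
  rw [lwdwDe, Matrix.diagonal_mul_diagonal, ← Matrix.diagonal_one]
  congr 1
  funext x
  have h := mul_self_entry hB i (e x)
  exact_mod_cast h

/-- `Tr D_i = Σ_t B_{it} B_{0t} = 0` for `i ≠ 0` when row `0` of `B` is all `+1`. [cite: LeeWeiDeWolf2017, Lemma 39 (p12, "the trace of all G_{ij} is zero")] -/
theorem trace_lwdwDe {B : Matrix (Fin (r + 1)) (Fin (r + 1)) ℤ} (hB : IsHadamardMatrix B)
    (h0 : ∀ t, B 0 t = 1) (e : Option (ZMod r) ≃ Fin (r + 1)) {i : Fin (r + 1)} (hi : i ≠ 0) :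
    (lwdwDe B e i).trace = 0 := by
  rw [lwdwDe, Matrix.trace_diagonal, e.sum_comp (fun t => ((B i t : ℤ) : ℂ))]
  have h := sum_mul_eq hB i 0
  rw [if_neg hi] at h
  simp_rw [h0, mul_one] at h
  exact_mod_cast h

/-- `Tr(D_i D_{i'}) = n [i = i']` (row orthogonality of `B`). [cite: LeeWeiDeWolf2017, Lemma 39 (p12, "Tr(G_{ij}G_{kl}^*) = δ_{ik}δ_{jl} n")] -/
theorem trace_lwdwDe_mul {B : Matrix (Fin (r + 1)) (Fin (r + 1)) ℤ} (hB : IsHadamardMatrix B)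
    (e : Option (ZMod r) ≃ Fin (r + 1)) (i i' : Fin (r + 1)) :
    (lwdwDe B e i * lwdwDe B e i').trace = if i = i' then ((r + 1 : ℕ) : ℂ) else 0 := by
  rw [lwdwDe, lwdwDe, Matrix.diagonal_mul_diagonal, Matrix.trace_diagonal,
    e.sum_comp (fun t => ((B i t : ℤ) : ℂ) * ((B i' t : ℤ) : ℂ))]
  have h := sum_mul_eq hB i i'
  rw [Fintype.card_fin] at h
  have h' : ((∑ t, B i t * B i' t : ℤ) : ℂ) = ((if i = i' then ((r + 1 : ℕ) : ℤ) else 0 : ℤ) : ℂ) := by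
    rw [h]
  push_cast at h'
  rw [h']
  split_ifs <;> simp

/-- `Tr(D_i G_{c,j}) = 0` (`G_{c,j}` has zero diagonal: disjoint supports). [cite: LeeWeiDeWolf2017, Lemma 39 (p12, "Tr(G_{ij}G_{kl}^*) = δ_{ik}δ_{jl} n")] -/
theorem trace_lwdwDe_mul_lwdwGe (hr : Odd r) (B : Matrix (Fin (r + 1)) (Fin (r + 1)) ℤ)
    (e : Option (ZMod r) ≃ Fin (r + 1)) (i : Fin (r + 1)) (c : ZMod r) (j : ZMod (r + 1)) :
    (lwdwDe B e i * lwdwGe c j).trace = 0 := by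
  rw [lwdwDe]
  simp only [Matrix.trace, Matrix.diag_apply, Matrix.diagonal_mul]
  refine Finset.sum_eq_zero fun x _ => ?_
  rw [lwdwGe_apply, if_neg (Ne.symm (lwdwPartner_ne_self hr c x)), mul_zero]

/-- `Tr(G_{c,j} D_i) = 0`. [cite: LeeWeiDeWolf2017, Lemma 39 (p12, "Tr(G_{ij}G_{kl}^*) = δ_{ik}δ_{jl} n")] -/
theorem trace_lwdwGe_mul_lwdwDe (hr : Odd r) (B : Matrix (Fin (r + 1)) (Fin (r + 1)) ℤ)
    (e : Option (ZMod r) ≃ Fin (r + 1)) (i : Fin (r + 1)) (c : ZMod r) (j : ZMod (r + 1)) :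
    (lwdwGe c j * lwdwDe B e i).trace = 0 := by
  rw [Matrix.trace_mul_comm, trace_lwdwDe_mul_lwdwGe hr]

/-! ### Theorem 40 (for Hadamard orders) -/

/-- `I + εG ⪰ 0` for a Hermitian involution `G` and `ε = ±1` (`(I + εG)² = 2(I + εG)`).
[cite: LeeWeiDeWolf2017, Thm. 38 proof (p12)] -/
private theorem posSemidef_one_add_smul_of_involution {m : Type*} [Fintype m] [DecidableEq m]
    {G : Matrix m m ℂ} (hG : Gᴴ = G) (hGG : G * G = 1) (ε : ℂ) (hε : ε = 1 ∨ ε = -1) :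
    (1 + ε • G).PosSemidef := by
  have hεε : ε * ε = 1 := by rcases hε with rfl | rfl <;> norm_num
  have hsq : (1 + ε • G) * (1 + ε • G) = (2 : ℂ) • (1 + ε • G) := by
    rw [add_mul, one_mul, mul_add, mul_one, Matrix.smul_mul, Matrix.mul_smul, hGG, smul_smul, hεε,
      one_smul, two_smul]
    abel
  have hH : (1 + ε • G)ᴴ = 1 + ε • G := by
    have hεr : star ε = ε := by rcases hε with rfl | rfl <;> simp
    rw [conjTranspose_add, conjTranspose_one, conjTranspose_smul, hG, hεr]
  have h : 1 + ε • G = ((1 / 2 : ℝ) : ℂ) • ((1 + ε • G)ᴴ * (1 + ε • G)) := by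
    rw [hH, hsq, smul_smul]
    norm_num
  rw [h]
  exact (posSemidef_conjTranspose_mul_self _).smul (Complex.zero_le_real.mpr (by norm_num))

/-- The `n² − 1` matrices of Lemma 39 (classes `c ∈ ℤ_r` with `n` fillings each, and the `n − 1`
diagonal matrices from rows `1, …, r` of `B`). [cite: LeeWeiDeWolf2017, Lemma 39 (p12)] -/
def lwdwGall (B : Matrix (Fin (r + 1)) (Fin (r + 1)) ℤ) (e : Option (ZMod r) ≃ Fin (r + 1)) :
    (ZMod r × ZMod (r + 1)) ⊕ Fin r → Matrix (Option (ZMod r)) (Option (ZMod r)) ℂ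
  | Sum.inl p => lwdwGe p.1 p.2
  | Sum.inr i => lwdwDe B e i.succ

/-- **LWdW Lemma 39 (repaired: with a row-normalized Hadamard matrix `B` of order `n` as the class
`i = 0`).** For even `n = r + 1` there are `n² − 1` Hermitian matrices `G_a` (`lwdwGall`) with
`G_a² = I`, `Tr G_a = 0` for all `a`, and `Tr(G_a G_b) = n·[a = b]`.
[cite: LeeWeiDeWolf2017, Lemma 39 (p12)] -/
theorem LeeWeiDeWolf2017_lemma39_of_hadamard (hr : Odd r) {B : Matrix (Fin (r + 1)) (Fin (r + 1)) ℤ}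
    (hB : IsHadamardMatrix B) (h0 : ∀ t, B 0 t = 1) (e : Option (ZMod r) ≃ Fin (r + 1)) :
    (∀ a, (lwdwGall B e a)ᴴ = lwdwGall B e a) ∧ (∀ a, lwdwGall B e a * lwdwGall B e a = 1) ∧
      (∀ a, (lwdwGall B e a).trace = 0) ∧
      ∀ a b, (lwdwGall B e a * lwdwGall B e b).trace = if a = b then ((r + 1 : ℕ) : ℂ) else 0 := by
  refine ⟨fun a => ?_, fun a => ?_, fun a => ?_, fun a b => ?_⟩
  · cases a with
    | inl p => exact lwdwGe_conjTranspose hr p.1 p.2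
    | inr i => exact lwdwDe_conjTranspose B e i.succ
  · cases a with
    | inl p => exact lwdwGe_mul_self hr p.1 p.2
    | inr i => exact lwdwDe_mul_self hB e i.succ
  · cases a with
    | inl p => exact trace_lwdwGe hr p.1 p.2
    | inr i => exact trace_lwdwDe hB h0 e (Fin.succ_ne_zero i)
  · cases a with
    | inl p =>
      cases b with
      | inl q =>
        simp only [lwdwGall, trace_lwdwGe_mul hr, Sum.inl.injEq, Prod.ext_iff]
      | inr i' =>
        simp only [lwdwGall, trace_lwdwGe_mul_lwdwDe hr, reduceCtorEq, if_false]
    | inr i =>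
      cases b with
      | inl q =>
        simp only [lwdwGall, trace_lwdwDe_mul_lwdwGe hr, reduceCtorEq, if_false]
      | inr i' =>
        simp only [lwdwGall, trace_lwdwDe_mul hB, Sum.inr.injEq, Fin.succ_inj]

/-- **LWdW Theorem 40, pair-indexed and scaled by `n`** (`n = r + 1` even, `B` a Hadamard matrix of
order `n`): with `X_a = I + G_a`, `Y_b = I − G_b` (psd), `Tr(X_a Y_b) = n + 0 − 0 − nδ_{ab} = n(1 − δ_{ab})`
on the index set `(ℤ_r × ℤ_n) ⊔ [r]` of size `n² − 1`. [cite: LeeWeiDeWolf2017, Thm. 40 (p12)] -/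
theorem hasComplexPsdFactorization_nonequality_even_smul (hr : Odd r)
    {B : Matrix (Fin (r + 1)) (Fin (r + 1)) ℤ} (hB : IsHadamardMatrix B) :
    HasComplexPsdFactorization
      (fun p q : (ZMod r × ZMod (r + 1)) ⊕ Fin r => ((r + 1 : ℕ) : ℝ) * (if p = q then (0 : ℝ) else 1))
      (r + 1) := by
  classical
  obtain ⟨hB', h0⟩ := isHadamardMatrix_normalizeRow hB 0
  let e : Option (ZMod r) ≃ Fin (r + 1) := Fintype.equivOfCardEq (by simp [ZMod.card])
  obtain ⟨hH, hI, htr, horth⟩ := LeeWeiDeWolf2017_lemma39_of_hadamard hr hB' h0 e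
  set G := lwdwGall (normalizeRow B 0) e with hG
  have htr' : ∀ Z : Matrix (Option (ZMod r)) (Option (ZMod r)) ℂ, (Z.submatrix e.symm e.symm).trace = Z.trace :=
    fun Z => by
      simp only [Matrix.trace, Matrix.diag_apply, Matrix.submatrix_apply]
      exact Fintype.sum_equiv e.symm _ _ fun x => rfl
  refine ⟨fun a => (1 + G a).submatrix e.symm e.symm, fun b => (1 - G b).submatrix e.symm e.symm,
    fun a => ?_, fun b => ?_, fun a b => ?_⟩
  · simpa using (posSemidef_one_add_smul_of_involution (hH a) (hI a) 1 (Or.inl rfl)).submatrix e.symm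
  · simpa [sub_eq_add_neg] using
      (posSemidef_one_add_smul_of_involution (hH b) (hI b) (-1) (Or.inr rfl)).submatrix e.symm
  rw [submatrix_mul_equiv, htr']
  simp only [add_mul, mul_sub, one_mul, mul_one, trace_add, trace_sub, trace_one, Fintype.card_option,
    ZMod.card, htr, horth]
  by_cases hab : a = b
  · subst hab
    simp only [if_true, mul_zero, Complex.ofReal_zero]
    push_cast
    ring
  · rw [if_neg hab, if_neg hab]
    push_cast
    ring

/-- **LWdW Theorem 40, pair-indexed**: the `(n²−1) × (n²−1)` nonequality matrix on `(ℤ_r × ℤ_n) ⊔ [r]`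
has a complex psd factorization of size `n`, `n = r + 1` a Hadamard order.
[cite: LeeWeiDeWolf2017, Thm. 40 (p12)] -/
theorem hasComplexPsdFactorization_nonequality_even (hr : Odd r)
    {B : Matrix (Fin (r + 1)) (Fin (r + 1)) ℤ} (hB : IsHadamardMatrix B) :
    HasComplexPsdFactorization
      (fun p q : (ZMod r × ZMod (r + 1)) ⊕ Fin r => if p = q then (0 : ℝ) else 1) (r + 1) := by
  have h := (hasComplexPsdFactorization_nonequality_even_smul hr hB).smul
    (c := 1 / ((r + 1 : ℕ) : ℝ)) (by positivity)
  have hn0 : ((r + 1 : ℕ) : ℝ) ≠ 0 := by positivity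
  convert h using 2 with p q
  field_simp

/-- **LWdW Theorem 40** (p12, verbatim: "Suppose `n` is even, and let `A_{n²−1}` be the nonequality
matrix of size `n²−1`. Then it holds that `rank_psd(A_{n²−1}) ≤ n`"), PROVED FOR HADAMARD ORDERS: if
`n ≥ 2` is even and a Hadamard matrix of order `n` exists, the `(n²−1) × (n²−1)` nonequality matrix has a
complex psd factorization of size `n` (Lemma 39's `G_a`, repaired with the Hadamard rows as the diagonal
class — see the SCOPE NOTE: the printed diagonal class is not Hermitian, and a Hermitian one exists iff a
Hadamard matrix of order `n` does; `X_a = I + G_a`, `Y_a = I − G_a`).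
[cite: LeeWeiDeWolf2017, Thm. 40 (p12)] -/
theorem LeeWeiDeWolf2017_thm40_of_hadamard {n : ℕ} (hn : Even n) (h0 : n ≠ 0)
    (hH : ∃ B : Matrix (Fin n) (Fin n) ℤ, IsHadamardMatrix B) :
    HasComplexPsdFactorization (derangementMatrix (n ^ 2 - 1)) n := by
  classical
  obtain ⟨r, rfl⟩ : ∃ r, n = r + 1 := Nat.exists_eq_succ_of_ne_zero h0
  have hr : Odd r := by
    rcases Nat.even_or_odd r with h | h
    · exact absurd hn (Nat.not_even_iff_odd.mpr (Even.add_one h))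
    · exact h
  haveI : NeZero r := ⟨by rintro rfl; exact (Nat.not_even_iff_odd.mpr odd_one) hn⟩
  obtain ⟨B, hB⟩ := hH
  have hcard : Fintype.card (Fin ((r + 1) ^ 2 - 1)) = Fintype.card ((ZMod r × ZMod (r + 1)) ⊕ Fin r) := by
    simp only [Fintype.card_fin, Fintype.card_sum, Fintype.card_prod, ZMod.card]
    have : (r + 1) ^ 2 = r * (r + 1) + r + 1 := by ring
    rw [this, Nat.add_sub_cancel]
  let f : Fin ((r + 1) ^ 2 - 1) ≃ (ZMod r × ZMod (r + 1)) ⊕ Fin r := Fintype.equivOfCardEq hcard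
  have h := (hasComplexPsdFactorization_nonequality_even hr hB).submatrix f f
  have heq : (fun i j => if f i = f j then (0 : ℝ) else 1) =
      (derangementMatrix ((r + 1) ^ 2 - 1) : Fin ((r + 1) ^ 2 - 1) → Fin ((r + 1) ^ 2 - 1) → ℝ) := by
    funext i j
    simp [f.injective.eq_iff]
  rw [heq] at h
  exact h

/-- **Theorem 40 for `n = 2^m`** (Sylvester's Hadamard matrices): the nonequality matrix of size
`4^m − 1` has complex psd rank `≤ 2^m`, `m ≥ 1`. [cite: LeeWeiDeWolf2017, Thm. 40 (p12)] -/
theorem LeeWeiDeWolf2017_thm40_two_pow {m : ℕ} (hm : 1 ≤ m) :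
    HasComplexPsdFactorization (derangementMatrix ((2 ^ m) ^ 2 - 1)) (2 ^ m) := by
  refine LeeWeiDeWolf2017_thm40_of_hadamard ?_ (by positivity) ?_
  · obtain ⟨k, rfl⟩ := Nat.exists_eq_add_of_le hm
    rw [pow_add, pow_one]
    exact even_two_mul _
  · exact Literature.Combinatorics.Designs.Paley.exists_isHadamardMatrix_two_pow m

/-- **Theorem 40 for `4 ∣ n ≤ 32`** (Sylvester/Paley Hadamard matrices of the tree).
[cite: LeeWeiDeWolf2017, Thm. 40 (p12)] -/
theorem LeeWeiDeWolf2017_thm40_of_four_dvd_le {n : ℕ} (h4 : 4 ∣ n) (h0 : n ≠ 0) (hn : n ≤ 32) :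
    HasComplexPsdFactorization (derangementMatrix (n ^ 2 - 1)) n :=
  LeeWeiDeWolf2017_thm40_of_hadamard (by obtain ⟨k, rfl⟩ := h4; exact ⟨2 * k, by ring⟩) h0
    (Literature.Combinatorics.Designs.Paley.exists_isHadamardMatrix_of_four_dvd_le h4 hn)

/-- **Theorem 40 for `n = 2`**: the `3 × 3` nonequality matrix has complex psd rank `≤ 2` (the Pauli
matrices `σ_x, σ_y, σ_z` are the three `G_a`). [cite: LeeWeiDeWolf2017, Thm. 40 (p12)] -/
theorem LeeWeiDeWolf2017_thm40_two : HasComplexPsdFactorization (derangementMatrix 3) 2 := by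
  have h := LeeWeiDeWolf2017_thm40_of_hadamard (n := 2) even_two two_ne_zero
    (Literature.Combinatorics.Designs.Paley.exists_isHadamardMatrix_two_pow 1)
  simpa using h

end NonequalityEven

/-! ### The obstruction behind the SCOPE NOTE: a Hermitian diagonal class needs a Hadamard matrix -/

section Obstruction

open Literature.Combinatorics.Designs.GoethalsSeidel (IsHadamardMatrix)

/-- **Why the printed diagonal class cannot be repaired for `n ≡ 2 (mod 4)`, `n ≥ 6`.** If `D_1, …, D_r`
are DIAGONAL complex `(r+1) × (r+1)` matrices with `D_a² = I` (the shape Theorem 40's proof needs from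
Lemma 39's class `i = 0`: `G G^* = I` with `G` Hermitian; for a diagonal involution the entries are `±1`, so
Hermitian is automatic), traceless, and pairwise orthogonal (`Tr(D_a D_b) = 0`, `a ≠ b`), then their
diagonals together with the all-ones vector are the rows of a Hadamard matrix of order `r + 1`; hence
`r + 1 ≤ 2` or `4 ∣ r + 1`. [cite: LeeWeiDeWolf2017, Lemma 39 proof (p12, "For i = 0
we use all the rows of V except V_0 … the trace of all G_{ij} is zero")] -/
theorem LeeWeiDeWolf2017_lemma39_diagonal_obstruction {r : ℕ}
    (D : Fin r → Matrix (Fin (r + 1)) (Fin (r + 1)) ℂ) (hdiag : ∀ a, (D a).IsDiag)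
    (hI : ∀ a, D a * D a = 1) (htr : ∀ a, (D a).trace = 0)
    (horth : ∀ a b, a ≠ b → (D a * D b).trace = 0) :
    (∃ B : Matrix (Fin (r + 1)) (Fin (r + 1)) ℤ, IsHadamardMatrix B ∧ (∀ t, B 0 t = 1) ∧
        ∀ a t, ((B a.succ t : ℤ) : ℂ) = D a t t) ∧
      (r + 1 ≤ 2 ∨ 4 ∣ r + 1) := by
  classical
  -- the diagonal entries are `±1`
  have hsq : ∀ a t, D a t t * D a t t = 1 := by
    intro a t
    have h := congrFun (congrFun (hI a) t) t
    rw [← (hdiag a).diagonal_diag, Matrix.diagonal_mul_diagonal, Matrix.diagonal_apply_eq] at h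
    simpa [Matrix.diag] using h
  have hpm : ∀ a t, D a t t = 1 ∨ D a t t = -1 := fun a t => mul_self_eq_one_iff.mp (hsq a t)
  -- the integer matrix
  let B : Matrix (Fin (r + 1)) (Fin (r + 1)) ℤ :=
    Matrix.of fun i t => Fin.cases (1 : ℤ) (fun a => if D a t t = 1 then 1 else -1) i
  have hB0 : ∀ t, B 0 t = 1 := fun t => by simp [B]
  have hBs : ∀ a t, ((B a.succ t : ℤ) : ℂ) = D a t t := by
    intro a t
    simp only [B, Matrix.of_apply, Fin.cases_succ]
    rcases hpm a t with h | h
    · rw [if_pos h, h]; simp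
    · rw [if_neg (by rw [h]; norm_num), h]; simp
  have hBpm : ∀ i t, B i t = 1 ∨ B i t = -1 := by
    intro i t
    refine Fin.cases (Or.inl (hB0 t)) (fun a => ?_) i
    simp only [B, Matrix.of_apply, Fin.cases_succ]
    split_ifs <;> simp
  -- traces of products of diagonal matrices
  have htrD : ∀ a b, (D a * D b).trace = ∑ t, D a t t * D b t t := by
    intro a b
    conv_lhs => rw [← (hdiag a).diagonal_diag, ← (hdiag b).diagonal_diag, Matrix.diagonal_mul_diagonal,
      Matrix.trace_diagonal]
    rfl
  -- row orthogonality of `B`, in `ℂ`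
  have hrow : ∀ i i' : Fin (r + 1), ((∑ t, B i t * B i' t : ℤ) : ℂ) =
      if i = i' then ((r + 1 : ℕ) : ℂ) else 0 := by
    intro i i'
    push_cast
    refine Fin.cases ?_ (fun a => ?_) i <;> refine Fin.cases ?_ (fun b => ?_) i'
    · simp [hB0]
    · rw [if_neg (Fin.succ_ne_zero b).symm]
      simp_rw [hB0, Int.cast_one, one_mul, hBs]
      have := htr b
      simpa [Matrix.trace, Matrix.diag] using this
    · rw [if_neg (Fin.succ_ne_zero a)]
      simp_rw [hB0, Int.cast_one, mul_one, hBs]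
      have := htr a
      simpa [Matrix.trace, Matrix.diag] using this
    · simp_rw [hBs, Fin.succ_inj]
      by_cases hab : a = b
      · subst hab
        simp [hsq]
      · rw [if_neg hab, ← htrD, horth a b hab]
  have hHad : IsHadamardMatrix B := by
    refine ⟨hBpm, ?_⟩
    ext i i'
    have h := hrow i i'
    rw [Matrix.mul_apply, Matrix.smul_apply, Matrix.one_apply, smul_eq_mul, Fintype.card_fin]
    simp only [Matrix.transpose_apply]
    split_ifs at h with hii
    · subst hii
      rw [if_pos rfl, mul_one]
      exact_mod_cast h
    · rw [if_neg hii, mul_zero]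
      exact_mod_cast h
  refine ⟨⟨B, hHad, hB0, hBs⟩, ?_⟩
  rcases Literature.Combinatorics.Designs.HadamardOrder.card_eq_one_or_two_or_four_dvd hHad with h | h | h
  · left; rw [Fintype.card_fin] at h; omega
  · left; rw [Fintype.card_fin] at h; omega
  · right; rwa [Fintype.card_fin] at h

/-- In particular for `n = 6` (`r = 5`): no five diagonal involutions of size `6` are traceless and
pairwise orthogonal — the printed route to `rank_psd(A_{35}) ≤ 6` is closed.
[cite: LeeWeiDeWolf2017, Thm. 40 (p12)] -/
theorem LeeWeiDeWolf2017_lemma39_no_diagonal_class_six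
    (D : Fin 5 → Matrix (Fin 6) (Fin 6) ℂ) (hdiag : ∀ a, (D a).IsDiag)
    (hI : ∀ a, D a * D a = 1) (htr : ∀ a, (D a).trace = 0) :
    ∃ a b, a ≠ b ∧ (D a * D b).trace ≠ 0 := by
  by_contra hne
  have hne' : ∀ a b, a ≠ b → (D a * D b).trace = 0 := fun a b hab => by
    by_contra h
    exact hne ⟨a, b, hab, h⟩
  have h := (LeeWeiDeWolf2017_lemma39_diagonal_obstruction D hdiag hI htr hne').2
  omega

end Obstruction

end Literature.Combinatorics.Optimization
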